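import Literature.AnabelianGeometry.EtaleTheta.FrobenioidThetaDivisors

/-!
# [EtTh] §5, Proposition 5.3 (ii), (iii) discharged for monoid type `ℤ`; (v) reduced to adjacency (pp. 325–327 / PDF pp. 99–101)

Mochizuki, *The étale theta function …*, Publ. RIMS **45** (2009)
[cite: MochizukiEtTh2009, Prop 5.3 p.325 (PDF p.99)].  Seat abc-iut-L2-d4 (wave-3 discharge of node `EtTh:Prop5.3`);
PROOF-ONLY over abc-iut-L2-t4's `FrobenioidThetaDivisors.lean` (`DivisorPrimeData`, `psiPhi`, `CuspPreserved`,
`PreservesNcspComponentIsos`, `PreservesCspComponentIsos`, `PreservesNcspLabels`) and the tree's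
`Frobenioids.Primes` / `Frobenioids.MonoidTransport` (`Primes.congr`, `Primes.submonoidCongr`).

Proposition 5.3 (ii), (iii) (p.325 (PDF p.99)): `Ψ^Φ_{A_⊚}` preserves "the natural isomorphisms between distinct
non-cuspidal primary components of `Φ(A_⊚)` [cf. Remark 3.8.2]" and "… between distinct cuspidal primary
components" ("determined by identifying the elements on each side that arise from [scheme-theoretic] prime
log-divisors", p.325 (PDF p.99)).  The §5 Frobenioid `C` is "of monoid type `ℤ`" (p.322 (PDF p.96), p.328 (PDF p.102)): each primary
component `Φ(A_⊚)_𝔭` is a copy of `ℤ_{≥0}` generated by its prime log-divisor, and between two copies of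
`ℤ_{≥0}` there is exactly ONE monoid isomorphism (`mulEquiv_eq_of_equiv_nat`).  Hence every monoid automorphism
of `Φ(A_⊚)` — in particular `Ψ^Φ_{A_⊚}` — is compatible with these isomorphisms: (ii), (iii) are PROVED under
the monoid-type-`ℤ` hypothesis `hN` ([FrdI] Def. 2.4 (i)).  Proposition 5.3 (v) (p.325 (PDF p.99): the bijection
`Prime(Φ(A_⊚))^ncsp ⥲ ℤ` "up to translation … and multiplication by `±1`") is REDUCED, as in print (p.327 (PDF p.101): "it
suffices to show that the relation of adjacency … is preserved"), to the preservation of adjacency, by the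
rigidity of the chain `ℤ` (`int_equiv_affine_of_adjacency`: an adjacency-preserving bijection of `ℤ` is
`i ↦ ±i + c`).  Clauses (i), (iv), (vi) and the adjacency step of (v) involve the cuspidal structure, linear
equivalence and the special fibre of `Ÿ` ("the well-known intersection theory of divisors supported on the
chain of copies of the projective line", p.326 (PDF p.100)), which `DivisorPrimeData` does not carry; reported separately.
HONEST FRAMING: kernel-checked statements about the typed data; typed ≠ discharged; no side taken. -/

namespace Literature.AnabelianGeometry.EtaleTheta

open CategoryTheory
open Literature.AlgebraicGeometry.Frobenioids

universe w v v' u u'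

namespace FrobenioidThetaDivisors

/-! ### Monoid type `ℤ`: uniqueness of isomorphisms between primary components -/

section MonoidTypeZ

/-- An automorphism of the additive monoid `ℕ` (written multiplicatively) is the identity: it sends the
generator `1` to a generator.  [cite: MochizukiEtTh2009, Prop 5.3 p.325 (PDF p.99)] -/
theorem mulEquiv_multiplicative_nat_eq_refl (f : Multiplicative ℕ ≃* Multiplicative ℕ) :
    f = MulEquiv.refl _ := by
  have key : ∀ n : ℕ, f (Multiplicative.ofAdd n) =
      Multiplicative.ofAdd (n * (f (Multiplicative.ofAdd 1)).toAdd) := by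
    intro n
    induction n with
    | zero => simp
    | succ n ih =>
      rw [show Multiplicative.ofAdd (n + 1) = Multiplicative.ofAdd n * Multiplicative.ofAdd 1 from rfl,
        map_mul, ih, Nat.succ_mul]
      rfl
  obtain ⟨m, hm⟩ := f.surjective (Multiplicative.ofAdd 1)
  have h1 : (f (Multiplicative.ofAdd 1)).toAdd = 1 := by
    have := congrArg Multiplicative.toAdd ((key m.toAdd).symm.trans (by simpa using hm))
    simp only [toAdd_ofAdd] at this
    exact Nat.eq_one_of_mul_eq_one_left this
  apply MulEquiv.ext
  intro n
  have := key n.toAdd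
  rw [h1, mul_one] at this
  simpa using this

/-- Between two monoids each isomorphic to `ℤ_{≥0}` there is exactly one monoid isomorphism ("the
natural isomorphism … determined by identifying the elements on each side that arise from prime
log-divisors", p.325 (PDF p.99); Rmk. 3.8.2).  [cite: MochizukiEtTh2009, Prop 5.3 p.325 (PDF p.99)] -/
theorem mulEquiv_eq_of_equiv_nat {A B : Type*} [Monoid A] [Monoid B]
    (iA : A ≃* Multiplicative ℕ) (iB : B ≃* Multiplicative ℕ) (e₁ e₂ : A ≃* B) : e₁ = e₂ := by
  have h : iA.symm.trans (e₁.trans iB) = iA.symm.trans (e₂.trans iB) := by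
    rw [mulEquiv_multiplicative_nat_eq_refl (iA.symm.trans (e₁.trans iB)),
      mulEquiv_multiplicative_nat_eq_refl (iA.symm.trans (e₂.trans iB))]
  apply MulEquiv.ext
  intro a
  have := MulEquiv.congr_fun h (iA a)
  simpa using this

end MonoidTypeZ

/-! ### Proposition 5.3 (i): the prime-level clause follows from the element-level clause -/

section CuspPrimes

variable {C : Type u} [Category.{v} C] {D : Type u'} [Category.{v'} D] {𝔉 : ThetaFrobenioid.{w} C D}
  (𝔓 : DivisorPrimeData 𝔉) (Ψ : C ≌ C) (ι : Ψ.functor.obj 𝔉.Acirc ≅ 𝔉.Acirc)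
  (e : 𝔉.PhiAcirc ≃* 𝔉.pre.Mon (𝔉.base.obj (Ψ.functor.obj 𝔉.Acirc)))

/-- **Proposition 5.3 (i), primes from elements**: if `Ψ^Φ_{A_⊚}` preserves the cuspidal ELEMENTS of `Φ(A_⊚)`
(Cor. 3.8 (iii)), then it preserves the cuspidal PRIMES — by abc-iut-L2-t4's link `isCuspidal_iff` (a prime is
cuspidal iff its primary elements are) and the transport of the subset `𝔭 ⊆ Φ` (`Primes.carrier_congr`).
[cite: MochizukiEtTh2009, Prop 5.3 (i) p.325 (PDF p.99)] -/
theorem cuspPreserved_of_elements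
    (h : ∀ a, 𝔓.IsCuspidalElt a ↔ 𝔓.IsCuspidalElt (psiPhi 𝔉 Ψ ι e a)) : CuspPreserved 𝔓 Ψ ι e := by
  intro p
  rw [𝔓.isCuspidal_iff, 𝔓.isCuspidal_iff, Primes.carrier_congr]
  constructor
  · intro H a ha
    exact (h a).mpr (H _ ⟨a, ha, rfl⟩)
  · rintro H _ ⟨a, ha, rfl⟩
    exact (h a).mp (H a ha)

end CuspPrimes

/-! ### Proposition 5.3 (ii), (iii) -/

section Prop53

variable {C : Type u} [Category.{v} C] {D : Type u'} [Category.{v'} D] {𝔉 : ThetaFrobenioid.{w} C D}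
  (𝔓 : DivisorPrimeData 𝔉) (Ψ : C ≌ C) (ι : Ψ.functor.obj 𝔉.Acirc ≅ 𝔉.Acirc)
  (e : 𝔉.PhiAcirc ≃* 𝔉.pre.Mon (𝔉.base.obj (Ψ.functor.obj 𝔉.Acirc)))

/-- The core computation, for any monoid automorphism `ψ` of `Φ(A_⊚)`: for ANY isomorphisms `j : Φ_𝔭 ⥲ Φ_𝔮`,
`j' : Φ_{ψ𝔭} ⥲ Φ_{ψ𝔮}` between primary components that are copies of `ℤ_{≥0}`, `ψ ∘ j = j' ∘ ψ` on `Φ_𝔭`.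
[cite: MochizukiEtTh2009, Prop 5.3 p.325 (PDF p.99)] -/
theorem apply_componentIso_eq (ψ : 𝔉.PhiAcirc ≃* 𝔉.PhiAcirc)
    (hN : ∀ 𝔭 : Primes 𝔉.PhiAcirc, Nonempty (𝔭.submonoid ≃* Multiplicative ℕ))
    (p q : Primes 𝔉.PhiAcirc) (j : p.submonoid ≃* q.submonoid)
    (j' : (Primes.congr ψ p).submonoid ≃* (Primes.congr ψ q).submonoid) (x : p.submonoid) :
    ψ (j x : 𝔉.PhiAcirc) = (j' (Primes.submonoidCongr ψ p _ rfl x) : 𝔉.PhiAcirc) := by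
  obtain ⟨iP⟩ := hN p
  obtain ⟨iQ'⟩ := hN (Primes.congr ψ q)
  have heq : j.trans (Primes.submonoidCongr ψ q _ rfl) = (Primes.submonoidCongr ψ p _ rfl).trans j' :=
    mulEquiv_eq_of_equiv_nat iP iQ' _ _
  exact congrArg (fun E : p.submonoid ≃* (Primes.congr ψ q).submonoid => ((E x : _) : 𝔉.PhiAcirc)) heq

/-- **[EtTh] Proposition 5.3 (ii), PROVED for monoid type `ℤ`**: `Ψ^Φ_{A_⊚}` is compatible with the natural
isomorphisms between non-cuspidal primary components (Rmk. 3.8.2) — for every `Ψ`, `ι`, `e`.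
[cite: MochizukiEtTh2009, Prop 5.3 (ii) p.325 (PDF p.99)] -/
theorem preservesNcspComponentIsos_of_monoidTypeZ (hc : CuspPreserved 𝔓 Ψ ι e)
    (hN : ∀ 𝔭 : Primes 𝔉.PhiAcirc, Nonempty (𝔭.submonoid ≃* Multiplicative ℕ)) :
    PreservesNcspComponentIsos 𝔓 Ψ ι e hc :=
  fun p q hp hq _ x => apply_componentIso_eq (psiPhi 𝔉 Ψ ι e) hN p q (𝔓.ncspIso p q hp hq) _ x

/-- **[EtTh] Proposition 5.3 (iii), PROVED for monoid type `ℤ`**: `Ψ^Φ_{A_⊚}` is compatible with the natural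
isomorphisms between cuspidal primary components (p.325 (PDF p.99): "all the cusps of `Ÿ^log` arise from `K̈`-rational
points … the cuspidal version of Remark 3.8.2") — for every `Ψ`, `ι`, `e`.
[cite: MochizukiEtTh2009, Prop 5.3 (iii) p.325 (PDF p.99)] -/
theorem preservesCspComponentIsos_of_monoidTypeZ (hc : CuspPreserved 𝔓 Ψ ι e)
    (hN : ∀ 𝔭 : Primes 𝔉.PhiAcirc, Nonempty (𝔭.submonoid ≃* Multiplicative ℕ)) :
    PreservesCspComponentIsos 𝔓 Ψ ι e hc :=
  fun p q hp hq _ x => apply_componentIso_eq (psiPhi 𝔉 Ψ ι e) hN p q (𝔓.cspIso p q hp hq) _ x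

end Prop53

/-! ### Proposition 5.3 (v): labels `Prime^ncsp ⥲ ℤ` up to `±1` and translation, from adjacency -/

section Labels

/-- **The rigidity of the chain.**  A bijection of `ℤ` that preserves the adjacency relation `|i - j| = 1`
(the "relation of adjacency [in the 'chain of copies of the projective line']", p.327 (PDF p.101)) is of the form
`i ↦ ε · i + c` with `ε = ±1` — which is why the bijection `Prime(Φ(A_⊚))^ncsp ⥲ ℤ` is "well-defined, up
to the operations of translation by an element of `ℤ` and multiplication by `±1`" (p.325 (PDF p.99)).
[cite: MochizukiEtTh2009, Prop 5.3 (v) p.327 (PDF p.101)] -/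
theorem int_equiv_affine_of_adjacency (σ : ℤ ≃ ℤ)
    (h : ∀ i j : ℤ, |i - j| = 1 → |σ i - σ j| = 1) :
    ∃ (ε : ℤˣ) (c : ℤ), ∀ i, σ i = (ε : ℤ) * i + c := by
  have h10 : |σ 1 - σ 0| = 1 := h 1 0 (by simp)
  obtain ⟨ε, hε⟩ : ∃ ε : ℤˣ, (ε : ℤ) = σ 1 - σ 0 := by
    rcases abs_eq (zero_le_one' ℤ) |>.mp h10 with h1 | h1
    · exact ⟨1, by simp [h1]⟩
    · exact ⟨-1, by simp [h1]⟩
  have hεabs : |(ε : ℤ)| = 1 := by rcases Int.units_eq_one_or ε with h1 | h1 <;> simp [h1]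
  have step : ∀ n : ℤ, σ (n + 1) - σ n = ε → σ (n + 2) - σ (n + 1) = ε := by
    intro n hn
    have h1 : |σ (n + 2) - σ (n + 1)| = 1 := h _ _ (by ring_nf; simp)
    have hne : σ (n + 2) ≠ σ n := fun heq => by
      have := σ.injective heq; omega
    rcases abs_eq (zero_le_one' ℤ) |>.mp h1 with h2 | h2 <;>
      rcases abs_eq (zero_le_one' ℤ) |>.mp hεabs with h3 | h3 <;> omega
  have stepd : ∀ n : ℤ, σ (n + 1) - σ n = ε → σ n - σ (n - 1) = ε := by
    intro n hn
    have h1 : |σ n - σ (n - 1)| = 1 := h _ _ (by ring_nf; simp)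
    have hne : σ (n + 1) ≠ σ (n - 1) := fun heq => by
      have := σ.injective heq; omega
    rcases abs_eq (zero_le_one' ℤ) |>.mp h1 with h2 | h2 <;>
      rcases abs_eq (zero_le_one' ℤ) |>.mp hεabs with h3 | h3 <;> omega
  have up : ∀ k : ℕ, σ ((k : ℤ) + 1) - σ k = ε := by
    intro k
    induction k with
    | zero => simpa using hε.symm
    | succ k ih =>
      rw [show ((k + 1 : ℕ) : ℤ) + 1 = (k : ℤ) + 2 by push_cast; ring,
        show ((k + 1 : ℕ) : ℤ) = (k : ℤ) + 1 by push_cast; ring]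
      exact step k ih
  have down : ∀ k : ℕ, σ (-(k : ℤ) + 1) - σ (-(k : ℤ)) = ε := by
    intro k
    induction k with
    | zero => simpa using hε.symm
    | succ k ih =>
      have := stepd (-(k : ℤ)) ih
      rw [show ((k + 1 : ℕ) : ℤ) = (k : ℤ) + 1 by push_cast; ring,
        show -((k : ℤ) + 1) + 1 = -(k : ℤ) by ring, show -((k : ℤ) + 1) = -(k : ℤ) - 1 by ring]
      exact this
  have all : ∀ n : ℤ, σ (n + 1) - σ n = ε := by
    intro n
    obtain ⟨k, rfl | rfl⟩ := Int.eq_nat_or_neg n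
    · exact up k
    · exact down k
  refine ⟨ε, σ 0, fun i => ?_⟩
  induction i using Int.induction_on with
  | zero => simp
  | succ k ih =>
    have := all k
    calc σ ((k : ℤ) + 1) = (σ ((k : ℤ) + 1) - σ k) + σ k := by ring
      _ = (ε : ℤ) + ((ε : ℤ) * k + σ 0) := by rw [this, ih]
      _ = (ε : ℤ) * ((k : ℤ) + 1) + σ 0 := by ring
  | pred k ih =>
    have := all (-(k : ℤ) - 1)
    rw [show -(k : ℤ) - 1 + 1 = -(k : ℤ) by ring] at this
    calc σ (-(k : ℤ) - 1) = σ (-(k : ℤ)) - (σ (-(k : ℤ)) - σ (-(k : ℤ) - 1)) := by ring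
      _ = ((ε : ℤ) * (-(k : ℤ)) + σ 0) - (ε : ℤ) := by rw [this, ih]
      _ = (ε : ℤ) * (-(k : ℤ) - 1) + σ 0 := by ring

variable {C : Type u} [Category.{v} C] {D : Type u'} [Category.{v'} D] {𝔉 : ThetaFrobenioid.{w} C D}
  (𝔓 : DivisorPrimeData 𝔉) (Ψ : C ≌ C) (ι : Ψ.functor.obj 𝔉.Acirc ≅ 𝔉.Acirc)
  (e : 𝔉.PhiAcirc ≃* 𝔉.pre.Mon (𝔉.base.obj (Ψ.functor.obj 𝔉.Acirc)))

/-- **[EtTh] Proposition 5.3 (v), reduced to adjacency** (the printed route, p.327 (PDF p.101): "To verify the preservation of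
(v), it suffices to show that the relation of adjacency … between elements `𝔭, 𝔮 ∈ Φ(A_⊚)^ncsp` is
preserved"): if `Ψ^Φ_{A_⊚}` preserves the cuspidal primes ((i)) and the adjacency of the labels of the
non-cuspidal primes (`hadj` — in print from "the well-known intersection theory of divisors supported on the
chain of copies of the projective line": adjacent iff every cuspidally minimal `c` linearly equivalent to
`a + b` has support of cardinality `4`), then it preserves the labels `Prime^ncsp ⥲ ℤ` up to `±1` and translation.
[cite: MochizukiEtTh2009, Prop 5.3 (v) p.327 (PDF p.101)] -/
theorem preservesNcspLabels_of_adjacency (hc : CuspPreserved 𝔓 Ψ ι e)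
    (hadj : ∀ (p q : Primes 𝔉.PhiAcirc) (hp : ¬ 𝔓.IsCuspidal p) (hq : ¬ 𝔓.IsCuspidal q),
      |𝔓.ncspEquivZ ⟨p, hp⟩ - 𝔓.ncspEquivZ ⟨q, hq⟩| = 1 →
        |𝔓.ncspEquivZ ⟨Primes.congr (psiPhi 𝔉 Ψ ι e) p, fun h => hp ((hc p).mp h)⟩ -
          𝔓.ncspEquivZ ⟨Primes.congr (psiPhi 𝔉 Ψ ι e) q, fun h => hq ((hc q).mp h)⟩| = 1) :
    PreservesNcspLabels 𝔓 Ψ ι e hc := by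
  -- `Ψ^Φ` on the non-cuspidal primes, as a bijection
  let τ : {p : Primes 𝔉.PhiAcirc // ¬ 𝔓.IsCuspidal p} ≃ {p : Primes 𝔉.PhiAcirc // ¬ 𝔓.IsCuspidal p} :=
    (Primes.congr (psiPhi 𝔉 Ψ ι e)).subtypeEquiv fun p => not_congr (hc p).symm
  let σ : ℤ ≃ ℤ := (𝔓.ncspEquivZ.symm.trans τ).trans 𝔓.ncspEquivZ
  have hσ : ∀ i j : ℤ, |i - j| = 1 → |σ i - σ j| = 1 := by
    intro i j hij
    have := hadj (𝔓.ncspEquivZ.symm i) (𝔓.ncspEquivZ.symm j) (𝔓.ncspEquivZ.symm i).2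
      (𝔓.ncspEquivZ.symm j).2
    simp only [Subtype.coe_eta, Equiv.apply_symm_apply] at this
    exact this hij
  obtain ⟨ε, c, hεc⟩ := int_equiv_affine_of_adjacency σ hσ
  refine ⟨ε, c, fun p hp => ?_⟩
  have := hεc (𝔓.ncspEquivZ ⟨p, hp⟩)
  simp only [σ, τ, Equiv.trans_apply, Equiv.symm_apply_apply, Equiv.subtypeEquiv_apply] at this
  exact this

end Labels

end FrobenioidThetaDivisors

end Literature.AnabelianGeometry.EtaleTheta
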